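import Summits.KontsevichZagierPeriods.KontsevichZagierPeriods.Theses.K2SymbolChains

/-!
# SteinbergChain (stmt-KontsevichZagierPeriods-5198) — typed decomposition along the cone Stokes argument

Pieces `SteinbergChainConeReps` (analytic existence of the three bulk representations over the cone
`w = s·γ(t)`, `(t,s) ∈ (a,b)×(0,1)`), `SteinbergChainArcStokes` (the `s`-direction: bulk ∼ arc `r₁ − r₂`),
`SteinbergChainRayStokes` (the `t`-direction: bulk ∼ rays `ρb − ρa`), and the proved glue
`SteinbergChain_of_subs : SteinbergChainConeReps → SteinbergChainArcStokes → SteinbergChainRayStokes → SteinbergChain`.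
Coordinates of the bulk: `w 0 = t`, `w 1 = s`, `w 2 = u`; of `P`: `x 0 = t`, `x 1 = s`.
-/

namespace Summit.KontsevichZagierPeriods.KontsevichZagierPeriods.Cruxes.SteinbergChain

/-- X₀ (support-sized crux): the bulk representations exist. -/
def SteinbergChainConeReps : Prop :=
  ∀ (a b : ℝ) (γ₁ γ₂ γ₁' γ₂' : ℝ → ℝ), a < b → Literature.NumberTheory.Transcendental.IsSemialgebraicFunOn ℚ {x : Fin 1 → ℝ | a < x 0 ∧ x 0 < b} (fun x => γ₁ (x 0)) → Literature.NumberTheory.Transcendental.IsSemialgebraicFunOn ℚ {x : Fin 1 → ℝ | a < x 0 ∧ x 0 < b} (fun x => γ₂ (x 0)) → ContinuousOn γ₁ (Set.Icc a b) → ContinuousOn γ₂ (Set.Icc a b) → (∀ t ∈ Set.Ioo a b, HasDerivAt γ₁ (γ₁' t) t ∧ HasDerivAt γ₂ (γ₂' t) t) → (∀ t ∈ Set.Icc a b, γ₁ t ^ 2 + γ₂ t ^ 2 ≠ 0 ∧ (γ₂ t ≠ 0 ∨ γ₁ t < 1)) → (Literature.NumberTheory.Transcendental.IsSemialgebraicFunOn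 ℚ {x : Fin 1 → ℝ | a < x 0 ∧ x 0 < b} (fun x => γ₁' (x 0)) ∧ Literature.NumberTheory.Transcendental.IsSemialgebraicFunOn ℚ {x : Fin 1 → ℝ | a < x 0 ∧ x 0 < b} (fun x => γ₂' (x 0)) ∧ MeasureTheory.IntegrableOn γ₁' (Set.Ioo a b) ∧ MeasureTheory.IntegrableOn γ₂' (Set.Ioo a b) ∧ ∃ (UΓ Us : Literature.NumberTheory.Transcendental.KZ.IntegralRep 3) (P : Literature.NumberTheory.Transcendental.KZ.IntegralRep 2), UΓ.domain = {w : Fin 3 → ℝ | a < w 0 ∧ w 0 < b ∧ 0 < w 1 ∧ w 1 < 1 ∧ ((1 < w 2 ∧ w 2 < γ₁ (w 0) ^ 2 + γ₂ (w 0) ^ 2) ∨ (γ₁ (w 0) ^ 2 + γ₂ (w 0) ^ 2 < w 2 ∧ w 2 < 1))} ∧ (∀ w ∈ UΓ.domain, UΓ.integrand w = (if 1 < w 2 then (1:ℝ) else -1) * ((-(γ₂' (w 0)) * ((1 - w 1 * γ₁ (w 0)) ^ 2 + (w 1 * γ₂ (w 0)) ^ 2) + γ₂ (w 0) * (-(2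 * w 1 * γ₁' (w 0) * (1 - w 1 * γ₁ (w 0))) + 2 * w 1 ^ 2 * γ₂ (w 0) * γ₂' (w 0))) / ((1 - w 1 * γ₁ (w 0)) ^ 2 + (w 1 * γ₂ (w 0)) ^ 2) ^ 2) / (2 * w 2)) ∧ Us.domain = {w : Fin 3 → ℝ | a < w 0 ∧ w 0 < b ∧ 0 < w 1 ∧ w 1 < 1 ∧ w 1 ^ 2 < w 2 ∧ w 2 < 1} ∧ (∀ w ∈ Us.domain, Us.integrand w = -((-(γ₂' (w 0)) * ((1 - w 1 * γ₁ (w 0)) ^ 2 + (w 1 * γ₂ (w 0)) ^ 2) + γ₂ (w 0) * (-(2 * w 1 * γ₁' (w 0) * (1 - w 1 * γ₁ (w 0))) + 2 * w 1 ^ 2 * γ₂ (w 0) * γ₂' (w 0))) / ((1 - w 1 * γ₁ (w 0)) ^ 2 + (w 1 * γ₂ (w 0)) ^ 2) ^ 2) / (2 * w 2)) ∧ P.domain = {x : Fin 2 → ℝ | a < x 0 ∧ x 0 < b ∧ 0 < x 1 ∧ x 1 < 1} ∧ (∀ x ∈ P.domain, P.integrand x = (-(γ₂ (x 0) * (γ₁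 (x 0) * γ₁' (x 0) + γ₂ (x 0) * γ₂' (x 0))) / ((γ₁ (x 0) ^ 2 + γ₂ (x 0) ^ 2) * ((1 - x 1 * γ₁ (x 0)) ^ 2 + (x 1 * γ₂ (x 0)) ^ 2)))))

/-- X₁ (crux): Stokes in the `s`-direction — bulk ∼ arc. -/
def SteinbergChainArcStokes : Prop :=
  ∀ (a b : ℝ) (γ₁ γ₂ γ₁' γ₂' : ℝ → ℝ) (r₁ r₂ : Literature.NumberTheory.Transcendental.KZ.IntegralRep 2) (UΓ Us : Literature.NumberTheory.Transcendental.KZ.IntegralRep 3) (P : Literature.NumberTheory.Transcendental.KZ.IntegralRep 2), a < b → Literature.NumberTheory.Transcendental.IsSemialgebraicFunOn ℚ {x : Fin 1 → ℝ | a < x 0 ∧ x 0 < b} (fun x => γ₁ (x 0)) → Literature.NumberTheory.Transcendental.IsSemialgebraicFunOn ℚ {x : Fin 1 → ℝ | a < x 0 ∧ x 0 < b} (fun x => γ₂ (x 0)) → ContinuousOn γ₁ (Set.Icc a b) → ContinuousOn γ₂ (Set.Icc a b) → (∀ t ∈ Set.Ioo a b, HasDerivAt γ₁ (γ₁' t)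 t ∧ HasDerivAt γ₂ (γ₂' t) t) → (∀ t ∈ Set.Icc a b, γ₁ t ^ 2 + γ₂ t ^ 2 ≠ 0 ∧ (γ₂ t ≠ 0 ∨ γ₁ t < 1)) → Literature.NumberTheory.Transcendental.IsSemialgebraicFunOn ℚ {x : Fin 1 → ℝ | a < x 0 ∧ x 0 < b} (fun x => γ₁' (x 0)) → Literature.NumberTheory.Transcendental.IsSemialgebraicFunOn ℚ {x : Fin 1 → ℝ | a < x 0 ∧ x 0 < b} (fun x => γ₂' (x 0)) → MeasureTheory.IntegrableOn γ₁' (Set.Ioo a b) → MeasureTheory.IntegrableOn γ₂' (Set.Ioo a b) → r₁.domain = {w | a < w 0 ∧ w 0 < b ∧ ((1 < w 1 ∧ w 1 < (γ₁ (w 0) ^ 2 + γ₂ (w 0) ^ 2)) ∨ ((γ₁ (w 0) ^ 2 + γ₂ (w 0) ^ 2) < w 1 ∧ w 1 < 1))} → (∀ w ∈ r₁.domain, r₁.integrand w = (if 1 < w 1 then (1:ℝ) else -1) * ((-(1 - γ₁ (w 0)) * γ₂' (w 0) - γ₂ (w 0) * γ₁' (w 0)) / ((1 - γ₁ (w 0))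 ^ 2 + γ₂ (w 0) ^ 2)) / (2 * w 1)) → r₂.domain = {w | a < w 0 ∧ w 0 < b ∧ ((1 < w 1 ∧ w 1 < ((1 - γ₁ (w 0)) ^ 2 + γ₂ (w 0) ^ 2)) ∨ (((1 - γ₁ (w 0)) ^ 2 + γ₂ (w 0) ^ 2) < w 1 ∧ w 1 < 1))} → (∀ w ∈ r₂.domain, r₂.integrand w = (if 1 < w 1 then (1:ℝ) else -1) * ((γ₁ (w 0) * γ₂' (w 0) - γ₂ (w 0) * γ₁' (w 0)) / (γ₁ (w 0) ^ 2 + γ₂ (w 0) ^ 2)) / (2 * w 1)) → UΓ.domain = {w : Fin 3 → ℝ | a < w 0 ∧ w 0 < b ∧ 0 < w 1 ∧ w 1 < 1 ∧ ((1 < w 2 ∧ w 2 < γ₁ (w 0) ^ 2 + γ₂ (w 0) ^ 2) ∨ (γ₁ (w 0) ^ 2 + γ₂ (w 0) ^ 2 < w 2 ∧ w 2 < 1))} → (∀ w ∈ UΓ.domain, UΓ.integrand w = (if 1 < w 2 then (1:ℝ) else -1) * ((-(γ₂' (w 0)) * ((1 - w 1 * γ₁ (w 0)) ^ 2 + (w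 1 * γ₂ (w 0)) ^ 2) + γ₂ (w 0) * (-(2 * w 1 * γ₁' (w 0) * (1 - w 1 * γ₁ (w 0))) + 2 * w 1 ^ 2 * γ₂ (w 0) * γ₂' (w 0))) / ((1 - w 1 * γ₁ (w 0)) ^ 2 + (w 1 * γ₂ (w 0)) ^ 2) ^ 2) / (2 * w 2)) → Us.domain = {w : Fin 3 → ℝ | a < w 0 ∧ w 0 < b ∧ 0 < w 1 ∧ w 1 < 1 ∧ w 1 ^ 2 < w 2 ∧ w 2 < 1} → (∀ w ∈ Us.domain, Us.integrand w = -((-(γ₂' (w 0)) * ((1 - w 1 * γ₁ (w 0)) ^ 2 + (w 1 * γ₂ (w 0)) ^ 2) + γ₂ (w 0) * (-(2 * w 1 * γ₁' (w 0) * (1 - w 1 * γ₁ (w 0))) + 2 * w 1 ^ 2 * γ₂ (w 0) * γ₂' (w 0))) / ((1 - w 1 * γ₁ (w 0)) ^ 2 + (w 1 * γ₂ (w 0)) ^ 2) ^ 2) / (2 * w 2)) → P.domain = {x : Fin 2 → ℝ | a < x 0 ∧ x 0 < b ∧ 0 < x 1 ∧ x 1 < 1} → (∀ x ∈ P.domain,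 P.integrand x = (-(γ₂ (x 0) * (γ₁ (x 0) * γ₁' (x 0) + γ₂ (x 0) * γ₂' (x 0))) / ((γ₁ (x 0) ^ 2 + γ₂ (x 0) ^ 2) * ((1 - x 1 * γ₁ (x 0)) ^ 2 + (x 1 * γ₂ (x 0)) ^ 2)))) → Literature.NumberTheory.Transcendental.KZ.of UΓ + Literature.NumberTheory.Transcendental.KZ.of Us + Literature.NumberTheory.Transcendental.KZ.of P - Literature.NumberTheory.Transcendental.KZ.of r₁ + Literature.NumberTheory.Transcendental.KZ.of r₂ ∈ Literature.NumberTheory.Transcendental.KZ.relations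

/-- X₂ (crux): Stokes in the `t`-direction — bulk ∼ rays. -/
def SteinbergChainRayStokes : Prop :=
  ∀ (a b : ℝ) (γ₁ γ₂ γ₁' γ₂' : ℝ → ℝ) (ρa ρb : Literature.NumberTheory.Transcendental.KZ.IntegralRep 2) (UΓ Us : Literature.NumberTheory.Transcendental.KZ.IntegralRep 3) (P : Literature.NumberTheory.Transcendental.KZ.IntegralRep 2), a < b → Literature.NumberTheory.Transcendental.IsSemialgebraicFunOn ℚ {x : Fin 1 → ℝ | a < x 0 ∧ x 0 < b} (fun x => γ₁ (x 0)) → Literature.NumberTheory.Transcendental.IsSemialgebraicFunOn ℚ {x : Fin 1 → ℝ | a < x 0 ∧ x 0 < b} (fun x => γ₂ (x 0)) → ContinuousOn γ₁ (Set.Icc a b) → ContinuousOn γ₂ (Set.Icc a b) → (∀ t ∈ Set.Ioo a b, HasDerivAt γ₁ (γ₁' t) t ∧ HasDerivAt γ₂ (γ₂' t) t) → (∀ t ∈ Set.Icc a b, γ₁ t ^ 2 + γ₂ t ^ 2 ≠ 0 ∧ (γ₂ t ≠ 0 ∨ γ₁ t < 1)) → Literature.NumberTheory.Transcendental.IsSemialgebraicFunOn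 ℚ {x : Fin 1 → ℝ | a < x 0 ∧ x 0 < b} (fun x => γ₁' (x 0)) → Literature.NumberTheory.Transcendental.IsSemialgebraicFunOn ℚ {x : Fin 1 → ℝ | a < x 0 ∧ x 0 < b} (fun x => γ₂' (x 0)) → MeasureTheory.IntegrableOn γ₁' (Set.Ioo a b) → MeasureTheory.IntegrableOn γ₂' (Set.Ioo a b) → ρa.domain = {w | 0 < w 0 ∧ w 0 < 1 ∧ ((1 < w 1 ∧ w 1 < w 0 ^ 2 * (γ₁ a ^ 2 + γ₂ a ^ 2)) ∨ (w 0 ^ 2 * (γ₁ a ^ 2 + γ₂ a ^ 2) < w 1 ∧ w 1 < 1))} → (∀ w ∈ ρa.domain, ρa.integrand w = (if 1 < w 1 then (1:ℝ) else -1) * (-(γ₂ a)) / (2 * w 1 * ((1 - w 0 * (γ₁ a)) ^ 2 + (w 0 * (γ₂ a)) ^ 2))) → ρb.domain = {w | 0 < w 0 ∧ w 0 < 1 ∧ ((1 < w 1 ∧ w 1 < w 0 ^ 2 * (γ₁ b ^ 2 + γ₂ b ^ 2)) ∨ (w 0 ^ 2 * (γ₁ b ^ 2 + γ₂ b ^ 2)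 < w 1 ∧ w 1 < 1))} → (∀ w ∈ ρb.domain, ρb.integrand w = (if 1 < w 1 then (1:ℝ) else -1) * (-(γ₂ b)) / (2 * w 1 * ((1 - w 0 * (γ₁ b)) ^ 2 + (w 0 * (γ₂ b)) ^ 2))) → UΓ.domain = {w : Fin 3 → ℝ | a < w 0 ∧ w 0 < b ∧ 0 < w 1 ∧ w 1 < 1 ∧ ((1 < w 2 ∧ w 2 < γ₁ (w 0) ^ 2 + γ₂ (w 0) ^ 2) ∨ (γ₁ (w 0) ^ 2 + γ₂ (w 0) ^ 2 < w 2 ∧ w 2 < 1))} → (∀ w ∈ UΓ.domain, UΓ.integrand w = (if 1 < w 2 then (1:ℝ) else -1) * ((-(γ₂' (w 0)) * ((1 - w 1 * γ₁ (w 0)) ^ 2 + (w 1 * γ₂ (w 0)) ^ 2) + γ₂ (w 0) * (-(2 * w 1 * γ₁' (w 0) * (1 - w 1 * γ₁ (w 0))) + 2 * w 1 ^ 2 * γ₂ (w 0) * γ₂' (w 0))) / ((1 - w 1 * γ₁ (w 0)) ^ 2 + (w 1 * γ₂ (w 0)) ^ 2) ^ 2) / (2 * w 2)) → Us.domain = {w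 : Fin 3 → ℝ | a < w 0 ∧ w 0 < b ∧ 0 < w 1 ∧ w 1 < 1 ∧ w 1 ^ 2 < w 2 ∧ w 2 < 1} → (∀ w ∈ Us.domain, Us.integrand w = -((-(γ₂' (w 0)) * ((1 - w 1 * γ₁ (w 0)) ^ 2 + (w 1 * γ₂ (w 0)) ^ 2) + γ₂ (w 0) * (-(2 * w 1 * γ₁' (w 0) * (1 - w 1 * γ₁ (w 0))) + 2 * w 1 ^ 2 * γ₂ (w 0) * γ₂' (w 0))) / ((1 - w 1 * γ₁ (w 0)) ^ 2 + (w 1 * γ₂ (w 0)) ^ 2) ^ 2) / (2 * w 2)) → P.domain = {x : Fin 2 → ℝ | a < x 0 ∧ x 0 < b ∧ 0 < x 1 ∧ x 1 < 1} → (∀ x ∈ P.domain, P.integrand x = (-(γ₂ (x 0) * (γ₁ (x 0) * γ₁' (x 0) + γ₂ (x 0) * γ₂' (x 0))) / ((γ₁ (x 0) ^ 2 + γ₂ (x 0) ^ 2) * ((1 - x 1 * γ₁ (x 0)) ^ 2 + (x 1 * γ₂ (x 0)) ^ 2)))) → Literature.NumberTheory.Transcendental.KZ.of UΓ + Literature.NumberTheory.Transcendental.KZ.of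 Us + Literature.NumberTheory.Transcendental.KZ.of P - Literature.NumberTheory.Transcendental.KZ.of ρb + Literature.NumberTheory.Transcendental.KZ.of ρa ∈ Literature.NumberTheory.Transcendental.KZ.relations

/-- The glue: `SteinbergChain` from the three pieces (obtain the bulk reps, subtract the two
Stokes identities). -/
theorem SteinbergChain_of_subs (h₀ : SteinbergChainConeReps) (h₁ : SteinbergChainArcStokes) (h₂ : SteinbergChainRayStokes) :
    Summit.KontsevichZagierPeriods.KontsevichZagierPeriods.Theses.K2SymbolChains.SteinbergChain := by
  intro a b γ₁ γ₂ γ₁' γ₂' r₁ r₂ ρa ρb hab hγ₁ hγ₂ hc₁ hc₂ hder hnv hr₁d hr₁i hr₂d hr₂i hρad hρai hρbd hρbi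
  obtain ⟨hγ₁', hγ₂', hi₁, hi₂, UΓ, Us, P, hUΓd, hUΓi, hUsd, hUsi, hPd, hPi⟩ :=
    h₀ a b γ₁ γ₂ γ₁' γ₂' hab hγ₁ hγ₂ hc₁ hc₂ hder hnv
  have hA := h₁ a b γ₁ γ₂ γ₁' γ₂' r₁ r₂ UΓ Us P hab hγ₁ hγ₂ hc₁ hc₂ hder hnv hγ₁' hγ₂' hi₁ hi₂
    hr₁d hr₁i hr₂d hr₂i hUΓd hUΓi hUsd hUsi hPd hPi
  have hB := h₂ a b γ₁ γ₂ γ₁' γ₂' ρa ρb UΓ Us P hab hγ₁ hγ₂ hc₁ hc₂ hder hnv hγ₁' hγ₂' hi₁ hi₂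
    hρad hρai hρbd hρbi hUΓd hUΓi hUsd hUsi hPd hPi
  have h := Literature.NumberTheory.Transcendental.KZ.relations.sub_mem hB hA
  convert h using 1
  abel

end Summit.KontsevichZagierPeriods.KontsevichZagierPeriods.Cruxes.SteinbergChain
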